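import Summits.HodgeConjecture.HodgeConjecture.Theses.AnchorTransport
import Summits.HodgeConjecture.HodgeConjecture.Theorems.AnchorTransportVariationalHodgeQuasiProjective
import Summits.HodgeConjecture.HodgeConjecture.Theorems.AnchorTransportVariationalHodgeCurveBase
import Literature.AlgebraicGeometry.HodgeTheory.MotivatedClasses
import Literature.AlgebraicGeometry.HodgeTheory.MotivatedClassesProofs
import Literature.AlgebraicGeometry.HodgeTheory.MotivatedClassesAlgebraic
import Literature.AlgebraicGeometry.HodgeTheory.GlobalInvariantCycles
import Literature.AlgebraicGeometry.HodgeTheory.LefschetzOneOneHolds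
import Literature.AlgebraicGeometry.HodgeTheory.HardLefschetzNFoldHolds
import Literature.AlgebraicGeometry.Motives.CurveThroughTwoPointsProofs

/-!
# Line `codim-split-motivic` — skeleton for crux `VariationalHodge` (stmt-HodgeConjecture-1076) and for
# EACH CHILD of its codimension split (crux-strategist cstrat-stmt-HodgeConjecture-1076-r1, 2026-08-17)

Route `AnchorTransport`, crux #2 `Summit.HodgeConjecture.HodgeConjecture.Theses.AnchorTransport.VariationalHodge`
(Grothendieck's variational Hodge conjecture, global-class form). This is the MOTIVIC line — the one
engine in print for Grothendieck's conjecture in every codimension: "the standard conjectures imply the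
variational Hodge conjecture, see [An]" (Charles–Schnell, *Notes on absolute Hodge classes*, remark
after Thm. 11.3.8): André's DEFORMATION THEOREM (André 1996, Thm. 0.5 — motivated classes are
transported along smooth projective families, by Deligne's théorème de la partie fixe and the
semisimplicity of motivated motives) carries the algebraic anchor class to a MOTIVATED class on every
fibre, and the Lefschetz standard conjecture `B` makes motivated classes algebraic (André 1996, §2.1).

It is registered (i) as a second line on the parent crux, next to the live deformation-theoretic line
`polar-patch-broken-cycles` (whose lever — semiregular broken-cycle representatives — it does not
touch: no representative of the anchor class is ever chosen here, so the STUCK point of that line, the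
truth analysis of asymptotic polar semiregularity `C⁺`, is dodged entirely; the price is `B`), and
(ii) as THE registered plan of the two children of the codimension split that no deformation-theoretic
line reaches — `VariationalHodgeHigherCodim` (`3 ≤ p ≤ n - 2`) and `VariationalHodgeTwoProper` (`p = 2`
on NON-quasi-projective total spaces) — and a second plan for `VariationalHodgeTwoQuasiProjective`.
The children are spelled out below (`ChildTwoQuasiProjective`, `ChildTwoProper`, `ChildHigherCodim`)
VERBATIM as filed in `children.json` of the split, so that once the gate renders them in the route
file the theorems `child…_of` close them by `exact` (definitional unfolding only).

## THE FOUR STUBS (`theorem stub_<name> : <Def> := by sorry`; `sorry` nowhere else)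

* B  `stub_lefschetzStandardB` — Grothendieck's standard conjecture of Lefschetz type for every smooth
  projective complex variety, André's form `StandardConjectureBStar` (⋆_L is an algebraic
  correspondence). VERBATIM the crux `LefschetzStandardB` of route `MotivatedLefschetzSplit`
  (item stmt-HodgeConjecture-17489): progress there closes this stub. THE HARDEST STUB (open since
  1968; known for curves, surfaces, abelian varieties, flag varieties, HK of K3^[n] type …).
* Δ  `stub_diagonalPullbackAlgebraic` — diagonal pull-back preserves the coniveau filtration
  (Voisin II Prop. 9.21 (i) + moving lemma). VERBATIM the support `DiagonalPullbackAlgebraic` of route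
  `MotivatedLefschetzSplit` (item stmt-HodgeConjecture-17490, difficulty L); the single input the tree
  isolates for "`B` ⇒ `A_mot ⊆ A`" (`motivatedClasses_le_algebraicClasses_of_standardConjectureB_of_map_diagonal`, proved).
* D  `stub_andreDeformation` — the named fact `Andre1996_deformation` (André 1996 Thm. 0.5 for
  PROJECTIVE smooth families over reduced connected bases of finite type); Literature programme
  `HodgeTheory/MotivatedClassesDeformation.lean` has isolated its inputs (A0)–(A5) and proved the
  bookkeeping ((A0) curve lemma now discharged, (A2) = `deligne_globalInvariantCycles`, (A4) proved).
* Dᶜ `stub_andreDeformationNonQuasiProjective` — André's theorem for smooth PROPER families whose total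
  space is NOT quasi-projective, over smooth irreducible affine curves (the ε beyond the printed
  theorem: Deligne, Hodge II, Thm. 4.1.1 is stated for `f` proper and smooth with a smooth COMPLETE
  compactification, so the partie fixe is available; André's semisimple lift then runs on a
  Chow–Hironaka projective cover of the compactification, the restriction-after-push-forward being an
  algebraic correspondence by Fulton's refined Gysin map). This stub is used ONLY off quasi-projective
  total spaces (children `TwoProper` and the non-quasi-projective part of `HigherCodim`).

Compositions (no `sorry`): `childTwoQuasiProjective_of : B → Δ → D → ChildTwoQuasiProjective`,
`childTwoProper_of : B → Δ → Dᶜ → ChildTwoProper`, `childHigherCodim_of : B → Δ → D → Dᶜ → ChildHigherCodim`,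
and `VariationalHodge_of : B → Δ → D → Dᶜ → VariationalHodge` (the crux BY NAME, through the tree's
unconditional curve-base/middle-range reduction `Theorems.variationalHodge_of_residual`). In the
quasi-projective case everything is the landed `Theorems.variationalHodge_quasiProjective_of_standardConjectureB`
(André's Thm. 0.5 as the named fact, `B ⇒ A_mot ⊆ A` from Δ, hard Lefschetz discharged); off it, the
anchor is motivated by `A ⊆ A_mot` (`algebraicClasses_le_motivatedClasses_of_nonempty_hardLefschetzNFold`,
hard Lefschetz discharged), Dᶜ deforms it, `B` + Δ make it algebraic.

## Disproof used

`Cruxes/VariationalHodge/Disproof.lean` (cdisprove cycle 1): no `_false_without_<H>` theorem exists short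
of `¬ HodgeConjecture` (`hodgeConjecture_imp`); `withoutAnchor_iff_hodgeConjecture` (the anchor carries
all content) — HONOURED: D/Dᶜ consume exactly the anchor (motivated-ness of `A|_{s₀}`), nothing is
claimed for anchor-free flat sections; `sketchStub_of_hodgeConjecture` (dead line `Sketch`, operator-supply
costume) — no stub quantifies over abstract transport operators: D is a printed theorem, B a conjecture
on single varieties INDEPENDENT of the crux (`V ⇏ B`), so no stub is the crux or the summit reworded
(per-stub probes in the strategist's folder `bc/`). No landed Negative lemma refutes an instance of B, Δ, D, Dᶜ.
-/

noncomputable section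

-- every declaration of this crux lives in `Summit.HodgeConjecture.HodgeConjecture.…` (summit = sub-problem)
set_option linter.dupNamespace false

open CategoryTheory CategoryTheory.Limits AlgebraicGeometry TopologicalSpace MonoidalCategory
open Literature.AlgebraicGeometry.Motives Literature.AlgebraicGeometry.HodgeTheory
open Summit.HodgeConjecture.HodgeConjecture.Theses.AnchorTransport
open Summit.HodgeConjecture.HodgeConjecture.Theorems

namespace Summit.HodgeConjecture.HodgeConjecture.Cruxes.VariationalHodge.CodimSplitMotivic

/-! ## §1 The three children of the codimension split, VERBATIM (as filed in `children.json`) -/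

/-- Child 1 (crux, rank 2): `p = 2`, quasi-projective total space, smooth irreducible affine bases, every `n`. -/
def ChildTwoQuasiProjective : Prop :=
  ∀ (n : ℕ) ⦃𝒳 S : Literature.AlgebraicGeometry.Motives.SchemeOver ℂ⦄ (f : 𝒳 ⟶ S), Literature.AlgebraicGeometry.Motives.IsSmoothProjectiveFamily f n → (∃ (P : Literature.AlgebraicGeometry.Motives.SchemeOver ℂ) (j : 𝒳 ⟶ P), Literature.AlgebraicGeometry.Motives.IsProjectiveOver P ∧ AlgebraicGeometry.IsOpenImmersion j.left) → IrreducibleSpace S.left → AlgebraicGeometry.IsAffine S.left → AlgebraicGeometry.Smooth S.hom → ∀ (A : Literature.AlgebraicGeometry.HodgeTheory.complexBetti 𝒳 (2 * 2)), (∀ s : Literature.AlgebraicGeometry.Motives.ComplexPoints S, Literature.AlgebraicGeometry.HodgeTheory.IsRationalClass (Literature.AlgebraicGeometry.HodgeTheory.complexBetti.map (Literature.AlgebraicGeometry.Motives.fiberι f s) (2 * 2) A) ∧ Literature.AlgebraicGeometry.HodgeTheory.IsOfHodgeType n (Literature.AlgebraicGeometry.Motives.fiberOver f s) (2 * 2)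 2 2 (Literature.AlgebraicGeometry.HodgeTheory.complexBetti.map (Literature.AlgebraicGeometry.Motives.fiberι f s) (2 * 2) A)) → (∃ s₀ : Literature.AlgebraicGeometry.Motives.ComplexPoints S, Literature.AlgebraicGeometry.HodgeTheory.complexBetti.map (Literature.AlgebraicGeometry.Motives.fiberι f s₀) (2 * 2) A ∈ Literature.AlgebraicGeometry.HodgeTheory.algebraicClasses (Literature.AlgebraicGeometry.Motives.fiberOver f s₀) 2) → ∀ s : Literature.AlgebraicGeometry.Motives.ComplexPoints S, Literature.AlgebraicGeometry.HodgeTheory.complexBetti.map (Literature.AlgebraicGeometry.Motives.fiberι f s) (2 * 2) A ∈ Literature.AlgebraicGeometry.HodgeTheory.algebraicClasses (Literature.AlgebraicGeometry.Motives.fiberOver f s) 2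

/-- Child 3 (crux, rank 4): `p = 2`, NON-quasi-projective total space, `n ≥ 4`, smooth irreducible affine curves. -/
def ChildTwoProper : Prop :=
  ∀ ⦃n : ℕ⦄ ⦃𝒳 S : Literature.AlgebraicGeometry.Motives.SchemeOver ℂ⦄ (f : 𝒳 ⟶ S), Literature.AlgebraicGeometry.Motives.IsSmoothProjectiveFamily f n → ¬ (∃ (P : Literature.AlgebraicGeometry.Motives.SchemeOver ℂ) (j : 𝒳 ⟶ P), Literature.AlgebraicGeometry.Motives.IsProjectiveOver P ∧ AlgebraicGeometry.IsOpenImmersion j.left) → IrreducibleSpace S.left → AlgebraicGeometry.IsAffine S.left → AlgebraicGeometry.Smooth S.hom → topologicalKrullDim S.left = 1 → 4 ≤ n → ∀ (A : Literature.AlgebraicGeometry.HodgeTheory.complexBetti 𝒳 (2 * 2)), (∀ s : Literature.AlgebraicGeometry.Motives.ComplexPoints S, Literature.AlgebraicGeometry.HodgeTheory.IsRationalClass (Literature.AlgebraicGeometry.HodgeTheory.complexBetti.map (Literature.AlgebraicGeometry.Motives.fiberι f s) (2 * 2) A) ∧ Literature.AlgebraicGeometry.HodgeTheory.IsOfHodgeType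 n (Literature.AlgebraicGeometry.Motives.fiberOver f s) (2 * 2) 2 2 (Literature.AlgebraicGeometry.HodgeTheory.complexBetti.map (Literature.AlgebraicGeometry.Motives.fiberι f s) (2 * 2) A)) → (∃ s₀ : Literature.AlgebraicGeometry.Motives.ComplexPoints S, Literature.AlgebraicGeometry.HodgeTheory.complexBetti.map (Literature.AlgebraicGeometry.Motives.fiberι f s₀) (2 * 2) A ∈ Literature.AlgebraicGeometry.HodgeTheory.algebraicClasses (Literature.AlgebraicGeometry.Motives.fiberOver f s₀) 2) → ∀ s : Literature.AlgebraicGeometry.Motives.ComplexPoints S, Literature.AlgebraicGeometry.HodgeTheory.complexBetti.map (Literature.AlgebraicGeometry.Motives.fiberι f s) (2 * 2) A ∈ Literature.AlgebraicGeometry.HodgeTheory.algebraicClasses (Literature.AlgebraicGeometry.Motives.fiberOver f s) 2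

/-- Child 2 (crux, rank 3): `3 ≤ p ≤ n - 2`, smooth irreducible affine curves, any total space. -/
def ChildHigherCodim : Prop :=
  ∀ ⦃n : ℕ⦄ ⦃𝒳 S : Literature.AlgebraicGeometry.Motives.SchemeOver ℂ⦄ (f : 𝒳 ⟶ S), Literature.AlgebraicGeometry.Motives.IsSmoothProjectiveFamily f n → IrreducibleSpace S.left → AlgebraicGeometry.IsAffine S.left → AlgebraicGeometry.Smooth S.hom → topologicalKrullDim S.left = 1 → ∀ (p : ℕ), 3 ≤ p → p + 2 ≤ n → ∀ (A : Literature.AlgebraicGeometry.HodgeTheory.complexBetti 𝒳 (2 * p)), (∀ s : Literature.AlgebraicGeometry.Motives.ComplexPoints S, Literature.AlgebraicGeometry.HodgeTheory.IsRationalClass (Literature.AlgebraicGeometry.HodgeTheory.complexBetti.map (Literature.AlgebraicGeometry.Motives.fiberι f s) (2 * p) A) ∧ Literature.AlgebraicGeometry.HodgeTheory.IsOfHodgeType n (Literature.AlgebraicGeometry.Motives.fiberOver f s) (2 * p) p p (Literature.AlgebraicGeometry.HodgeTheory.complexBetti.map (Literature.AlgebraicGeometry.Motives.fiberι f s) (2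 * p) A)) → (∃ s₀ : Literature.AlgebraicGeometry.Motives.ComplexPoints S, Literature.AlgebraicGeometry.HodgeTheory.complexBetti.map (Literature.AlgebraicGeometry.Motives.fiberι f s₀) (2 * p) A ∈ Literature.AlgebraicGeometry.HodgeTheory.algebraicClasses (Literature.AlgebraicGeometry.Motives.fiberOver f s₀) p) → ∀ s : Literature.AlgebraicGeometry.Motives.ComplexPoints S, Literature.AlgebraicGeometry.HodgeTheory.complexBetti.map (Literature.AlgebraicGeometry.Motives.fiberι f s) (2 * p) A ∈ Literature.AlgebraicGeometry.HodgeTheory.algebraicClasses (Literature.AlgebraicGeometry.Motives.fiberOver f s) p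

/-! ## §2 Statements of the stubs -/

/-- Statement of STUB B — Grothendieck's standard conjecture of Lefschetz type, André's form, for every
smooth projective complex variety and every polarisation class (VERBATIM item stmt-HodgeConjecture-17489,
`MotivatedLefschetzSplit.LefschetzStandardB`). [Kleiman1968AlgebraicCycles; Andre1996Motifs §0.3] -/
def LefschetzStandardB : Prop :=
  ∀ (d : ℕ) (Z : SchemeOver ℂ) (η : complexBetti Z 2), IsSmoothProjective d Z → StandardConjectureBStar d Z η

/-- Statement of STUB Δ — diagonal pull-back preserves the coniveau (VERBATIM item
stmt-HodgeConjecture-17490, `MotivatedLefschetzSplit.DiagonalPullbackAlgebraic`). [VoisinHodgeII2003 Prop. 9.21 (i)] -/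
def DiagonalPullbackAlgebraic : Prop :=
  ∀ ⦃d : ℕ⦄ ⦃V : SchemeOver ℂ⦄, IsSmoothProjective d V → ∀ (p : ℕ) ⦃c : complexBetti (V ⊗ V) (2 * p)⦄,
    c ∈ algebraicClasses (V ⊗ V) p →
      complexBetti.map (CartesianMonoidalCategory.lift (𝟙 V) (𝟙 V)) (2 * p) c ∈ algebraicClasses V p

/-- Statement of STUB D — André's deformation theorem, the tree's named fact verbatim. [Andre1996Motifs Thm. 0.5] -/
def AndreDeformation : Prop :=
  Andre1996_deformation

/-- Statement of STUB Dᶜ — **André's deformation theorem off quasi-projective total spaces**: for a smooth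
PROPER family `f : 𝒳 ⟶ S` of relative dimension `n` with projective fibres whose total space admits NO
open immersion into a projective `ℂ`-scheme, over a smooth irreducible affine CURVE, a global class
`A ∈ H²ᵖ(𝒳(ℂ); ℂ)` motivated on one fibre is motivated on every fibre. The ε beyond Thm. 0.5 as printed
(projective `f`): Deligne's partie fixe (Hodge II 4.1.1) is stated for proper smooth `f` with a smooth
complete compactification `X̄ ⊇ 𝒳`; André's lift (§5.1 (A3)) is then run on a smooth projective
Chow–Hironaka cover `X̃ → X̄`, the composite `H(X̃) → H(X̄) → H(𝒳_{s₀})` being an algebraic correspondence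
(refined Gysin). [DeligneHodgeII1971 Thm. 4.1.1; Andre1996Motifs §5.1; Fulton1998 Ch. 6] -/
def AndreDeformationNonQuasiProjective : Prop :=
  ∀ ⦃n : ℕ⦄ ⦃𝒳 S : SchemeOver ℂ⦄ (f : 𝒳 ⟶ S), IsSmoothProjectiveFamily f n → ¬ IsQuasiProjectiveOver 𝒳 →
    IrreducibleSpace S.left → IsAffine S.left → AlgebraicGeometry.Smooth S.hom → topologicalKrullDim S.left = 1 →
    ∀ (p : ℕ) (A : complexBetti 𝒳 (2 * p)) (s₀ : ComplexPoints S),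
      complexBetti.map (fiberι f s₀) (2 * p) A ∈ motivatedClasses n (fiberOver f s₀) p →
      ∀ s : ComplexPoints S, complexBetti.map (fiberι f s) (2 * p) A ∈ motivatedClasses n (fiberOver f s) p

/-! ## §3 Registered stubs (`sorry` lives ONLY in these four theorems) -/

/-- STUB B (hardest; shared with route MotivatedLefschetzSplit, item stmt-HodgeConjecture-17489). -/
theorem stub_lefschetzStandardB : LefschetzStandardB := by
  sorry

/-- STUB Δ (shared with route MotivatedLefschetzSplit, item stmt-HodgeConjecture-17490; difficulty L). -/
theorem stub_diagonalPullbackAlgebraic : DiagonalPullbackAlgebraic := by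
  sorry

/-- STUB D (named fact `Andre1996_deformation`; Literature programme `MotivatedClassesDeformation.lean`). -/
theorem stub_andreDeformation : AndreDeformation := by
  sorry

/-- STUB Dᶜ (André's theorem off quasi-projective total spaces; size L–XL: Deligne partie fixe for proper
`f` + smooth completion + Chow–Hironaka cover + refined-Gysin correspondence + André's semisimple lift). -/
theorem stub_andreDeformationNonQuasiProjective : AndreDeformationNonQuasiProjective := by
  sorry

/-! ### Name-keyed aliases (the skeleton audit matches a hypothesis head to a declared stub by its last
name component) -/
namespace Registered

/-- Alias keyed by the registered stub name. -/
abbrev stub_lefschetzStandardB : Prop := LefschetzStandardB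
/-- Alias keyed by the registered stub name. -/
abbrev stub_diagonalPullbackAlgebraic : Prop := DiagonalPullbackAlgebraic
/-- Alias keyed by the registered stub name. -/
abbrev stub_andreDeformation : Prop := AndreDeformation
/-- Alias keyed by the registered stub name. -/
abbrev stub_andreDeformationNonQuasiProjective : Prop := AndreDeformationNonQuasiProjective

end Registered

/-! ## §4 Composition (no `sorry` below this line) -/

section Composition

variable {n : ℕ} {𝒳 S : SchemeOver ℂ}

/-- **The quasi-projective case, every codimension** — the landed
`Theorems.variationalHodge_quasiProjective_of_standardConjectureB` (André Thm. 0.5 as the named fact D,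
`B ⇒ A_mot ⊆ A` from Δ through `motivatedClasses_le_algebraicClasses_of_standardConjectureB_of_map_diagonal`,
hard Lefschetz discharged by `nonempty_hardLefschetzNFold_holds`). -/
theorem conclusion_of_quasiProjective (hB : Registered.stub_lefschetzStandardB)
    (hΔ : Registered.stub_diagonalPullbackAlgebraic) (hD : Registered.stub_andreDeformation)
    (f : 𝒳 ⟶ S) (hf : IsSmoothProjectiveFamily f n) (hqp : IsQuasiProjectiveOver 𝒳)
    (hirr : IrreducibleSpace S.left) (hsm : AlgebraicGeometry.Smooth S.hom) (p : ℕ) (A : complexBetti 𝒳 (2 * p))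
    (hA : ∀ s : ComplexPoints S, IsRationalClass (complexBetti.map (fiberι f s) (2 * p) A) ∧
      IsOfHodgeType n (fiberOver f s) (2 * p) p p (complexBetti.map (fiberι f s) (2 * p) A))
    (hs₀ : ∃ s₀ : ComplexPoints S, complexBetti.map (fiberι f s₀) (2 * p) A ∈ algebraicClasses (fiberOver f s₀) p)
    (s : ComplexPoints S) :
    complexBetti.map (fiberι f s) (2 * p) A ∈ algebraicClasses (fiberOver f s) p :=
  variationalHodge_quasiProjective_of_standardConjectureB hB
    (motivatedClasses_le_algebraicClasses_of_standardConjectureB_of_map_diagonal hΔ) hD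
    nonempty_hardLefschetzNFold_holds f hf hqp hirr hsm p A hA hs₀ s

/-- **Off quasi-projective total spaces, every codimension** (over a smooth irreducible affine curve):
the anchor is motivated by `A ⊆ A_mot` (hard Lefschetz discharged), Dᶜ deforms it, `B` + Δ make the
deformed class algebraic. The fibrewise Hodge hypotheses are not used. -/
theorem conclusion_of_not_quasiProjective (hB : Registered.stub_lefschetzStandardB)
    (hΔ : Registered.stub_diagonalPullbackAlgebraic) (hDc : Registered.stub_andreDeformationNonQuasiProjective)
    (f : 𝒳 ⟶ S) (hf : IsSmoothProjectiveFamily f n) (hqp : ¬ IsQuasiProjectiveOver 𝒳)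
    (hirr : IrreducibleSpace S.left) (haff : IsAffine S.left) (hsm : AlgebraicGeometry.Smooth S.hom)
    (hdim : topologicalKrullDim S.left = 1) (p : ℕ) (A : complexBetti 𝒳 (2 * p))
    (hs₀ : ∃ s₀ : ComplexPoints S, complexBetti.map (fiberι f s₀) (2 * p) A ∈ algebraicClasses (fiberOver f s₀) p)
    (s : ComplexPoints S) :
    complexBetti.map (fiberι f s) (2 * p) A ∈ algebraicClasses (fiberOver f s) p := by
  obtain ⟨s₀, hs₀⟩ := hs₀
  have hmot₀ : complexBetti.map (fiberι f s₀) (2 * p) A ∈ motivatedClasses n (fiberOver f s₀) p :=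
    algebraicClasses_le_motivatedClasses_of_nonempty_hardLefschetzNFold (hf.isSmoothProjective s₀)
      (nonempty_hardLefschetzNFold_holds _ _) p hs₀
  have hmot : complexBetti.map (fiberι f s) (2 * p) A ∈ motivatedClasses n (fiberOver f s) p :=
    hDc f hf hqp hirr haff hsm hdim p A s₀ hmot₀ s
  exact motivatedClasses_le_algebraicClasses_of_standardConjectureB_of_map_diagonal hΔ hB
    (hf.isSmoothProjective s) p hmot

/-- **CHILD 1 from B, Δ, D** (quasi-projective total space, `p = 2`, affine bases of any dimension). -/
theorem childTwoQuasiProjective_of (hB : Registered.stub_lefschetzStandardB)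
    (hΔ : Registered.stub_diagonalPullbackAlgebraic) (hD : Registered.stub_andreDeformation) :
    ChildTwoQuasiProjective :=
  fun _ _ _ f hf hqp hirr _ hsm A hA hs₀ s => conclusion_of_quasiProjective hB hΔ hD f hf hqp hirr hsm 2 A hA hs₀ s

/-- **CHILD 3 from B, Δ, Dᶜ** (non-quasi-projective total space, `p = 2`, `n ≥ 4`, affine curves). -/
theorem childTwoProper_of (hB : Registered.stub_lefschetzStandardB)
    (hΔ : Registered.stub_diagonalPullbackAlgebraic) (hDc : Registered.stub_andreDeformationNonQuasiProjective) :
    ChildTwoProper :=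
  fun _ _ _ f hf hqp hirr haff hsm hdim _ A _ hs₀ s =>
    conclusion_of_not_quasiProjective hB hΔ hDc f hf hqp hirr haff hsm hdim 2 A hs₀ s

/-- **CHILD 2 from B, Δ, D, Dᶜ** (`3 ≤ p ≤ n - 2`, affine curves, any total space). -/
theorem childHigherCodim_of (hB : Registered.stub_lefschetzStandardB)
    (hΔ : Registered.stub_diagonalPullbackAlgebraic) (hD : Registered.stub_andreDeformation)
    (hDc : Registered.stub_andreDeformationNonQuasiProjective) : ChildHigherCodim := by
  intro n 𝒳 S f hf hirr haff hsm hdim p _ _ A hA hs₀ s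
  by_cases hqp : IsQuasiProjectiveOver 𝒳
  · exact conclusion_of_quasiProjective hB hΔ hD f hf hqp hirr hsm p A hA hs₀ s
  · exact conclusion_of_not_quasiProjective hB hΔ hDc f hf hqp hirr haff hsm hdim p A hs₀ s

/-- **`VariationalHodge_of` — THE SKELETON THEOREM**: the four registered stubs imply the crux
`AnchorTransport.VariationalHodge` BY NAME. Reduce to smooth irreducible affine CURVE bases and the
middle range (`Theorems.variationalHodge_of_residual`, unconditional with the discharged facts
`lefschetzOneOne_rational_holds`, `nonempty_hardLefschetzNFold_holds`,
`mumford_smoothCurve_through_two_points_holds`), then the motivic conclusion in either case. -/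
theorem VariationalHodge_of (hB : Registered.stub_lefschetzStandardB)
    (hΔ : Registered.stub_diagonalPullbackAlgebraic) (hD : Registered.stub_andreDeformation)
    (hDc : Registered.stub_andreDeformationNonQuasiProjective) : VariationalHodge := by
  refine variationalHodge_of_residual lefschetzOneOne_rational_holds nonempty_hardLefschetzNFold_holds
    mumford_smoothCurve_through_two_points_holds
    fun n 𝒳 S f hf hirr haff hsm hdim p _ _ A hA hs₀ s => ?_
  by_cases hqp : IsQuasiProjectiveOver 𝒳
  · exact conclusion_of_quasiProjective hB hΔ hD f hf hqp hirr hsm p A hA hs₀ s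
  · exact conclusion_of_not_quasiProjective hB hΔ hDc f hf hqp hirr haff hsm hdim p A hs₀ s

/-- The same through the three children and the strategist's split glue (re-proved inline: reduce to
curves and the middle range, split `p = 2` quasi-projective or not / `3 ≤ p`), certifying that the
children as typed ARE what the motivic line closes. -/
theorem VariationalHodge_of_children (h₁ : ChildTwoQuasiProjective) (h₂ : ChildTwoProper)
    (h₃ : ChildHigherCodim) : VariationalHodge := by
  refine variationalHodge_of_residual lefschetzOneOne_rational_holds nonempty_hardLefschetzNFold_holds
    mumford_smoothCurve_through_two_points_holds
    fun n 𝒳 S f hf hirr haff hsm hdim p hp2 hpn A hA hs₀ s => ?_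
  rcases Nat.eq_or_lt_of_le hp2 with rfl | hp3
  · by_cases hqp : ∃ (P : SchemeOver ℂ) (j : 𝒳 ⟶ P), IsProjectiveOver P ∧ IsOpenImmersion j.left
    · exact h₁ n f hf hqp hirr haff hsm A hA hs₀ s
    · exact h₂ f hf hqp hirr haff hsm hdim (by omega) A hA hs₀ s
  · exact h₃ f hf hirr haff hsm hdim p (by omega) hpn A hA hs₀ s

/-- Wiring check: the registered stubs feed the composition as stated (this theorem depends on the four
`sorry`s and on nothing else). -/
theorem variationalHodge_holds_of_stubs : VariationalHodge :=
  VariationalHodge_of stub_lefschetzStandardB stub_diagonalPullbackAlgebraic stub_andreDeformation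
    stub_andreDeformationNonQuasiProjective

/-- Wiring check through the children. -/
theorem variationalHodge_holds_of_children_of_stubs : VariationalHodge :=
  VariationalHodge_of_children
    (childTwoQuasiProjective_of stub_lefschetzStandardB stub_diagonalPullbackAlgebraic stub_andreDeformation)
    (childTwoProper_of stub_lefschetzStandardB stub_diagonalPullbackAlgebraic stub_andreDeformationNonQuasiProjective)
    (childHigherCodim_of stub_lefschetzStandardB stub_diagonalPullbackAlgebraic stub_andreDeformation
      stub_andreDeformationNonQuasiProjective)

end Composition

end Summit.HodgeConjecture.HodgeConjecture.Cruxes.VariationalHodge.CodimSplitMotivic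

end
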